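import Summits.QuantumFields.BalabanUV.Beta.WardLocusRecursiveAllSlot
import Summits.QuantumFields.BalabanUV.Beta.WardLocusResidualSlot

/-!
# `BalabanUV.Beta.WardLocusRecursiveLettersSlot` — binder row D1, SECOND-ORDER hW (W-side), SLOT-GENERIC FINAL part: THE ALL-LEVELS WARD KERNEL LAW OF
# THE SLOTTED W-TABLES `WrecOf G (SpureRecOf V H G) M …` FROM THE LETTERS — by ONE induction over the levels carrying (kernel law, residual class, residual
# parity): parts A (`WardLocusQuarticTableSlot`), B (`WardLocusRecursiveStepSlot`), C (`WardLocusRecursiveAllSlot`), Q1∕Q2 (`WardLocusResidualSlot`) composed;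
# the twin of `WardLocusRecursiveLetters` §1 with the wall objects replaced by SLOTS under DISPLAYED resolvent sockets and table parities
# (β sub-cell, BINDER-OWNERS row D1 OWNER `b2b-balaban-beta-an2`, gen 29; INTENT «SYM-hW-SECOND-ORDER» journal [AN2-G29-ONLINE])

HONEST FRAMING (cell charter, verbatim): «discharging BetaPertH makes Bałaban's UV stability UNCONDITIONAL — a real constructive-QFT result; it is
NOT the continuum limit and NOT the Clay problem.»  HONEST DEPENDENCY: continuum YM on T⁴ ⇐ BetaPertH ∧ nine spine estimates (0/9 proved);
BetaPertH ⇐ (D1) ∧ (D4) ∧ CAP+tail; G-an2-4 gates asym, D1 and NE2/3/4.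
NOT IN PRINT; OUR BOOKKEEPING.  [folklore] composition; DISPLAYED HYPOTHESES: the slots' letters (LV)(LH)(DG)(LM)∕`hB`∕`hmix`; the resolvent sockets of every
level (`Spr (𝕄 j)`, `Spr E`, `RelInv (G j) (𝕄 j) E`, ℋ-column Ward law with constants `cH j`, multiplier-column Ward law, off-lattice vanishing, `[E, X y] = 0`,
first-order law `hD`, order-one consistency (c1), sgn-symmetry `trK (G j) = sgnK (G j)`); the ROW PARITIES of the pure tables `SpureRecOf … j` and of the
multiplier tables `M j`; the units locks; the LETTERS — border Ward law of the `vh₂S` sector in both slots at every level `j ≥ 0`, mixed Ward law of `M2Of mixFF j`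
at every level, the level-`0` Wilson Ward law of `cE₂ • wilsonW₂ d T` — with their remainders' classes (one rate per level) and row parities.  No statement of
Bałaban's papers, no `[cite:]`, no `def`, no `def … : Prop`; instantiates NO binder of the β-function wall.  hW is REDUCED TO LETTERS here for ANY slots, NOT
discharged; NOT D1, NOT `BetaPertH`, NOT continuum, NOT Clay.

* §1 **`exists_kernelLaws_of_letters_slot`** (generic `d`, generic slots, root `r`, scale `ξ`): there is a residual family `Nr : ℕ → …` (built by recursion on
  the level from the letters' remainders: level `0` = part C §1's residual, level `j+1` = part C §2's residual over `Nr j`) such that for EVERY `j`: (class)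
  `Nr j y` is a vertex family in `(ν, y′)` uniformly in `y`; (parity) its rows are parity-odd; (law)
  `divW (WrecOf … j) y ν y′ = conjV (dM (G j) Lc (SpureRecOf … j) (M j) ν y′) (X y) + Nr j y ν y′`.
Instances: the comb (`WardLocusRecursiveLetters`) and the (0.4) literal «JsB12Sym» (row owner's next file).
Provenance: β sub-cell, unit beta-an2 gen 29, 2026-08-21 (v1); over parts A∕B∕C∕Q BY NAME; no existing file touched.
-/

noncomputable section

open Finset
open scoped BigOperators
open Literature.MathematicalPhysics.QuantumFieldTheory
open Literature.MathematicalPhysics.QuantumFieldTheory.Balaban1983to89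
open Literature.MathematicalPhysics.QuantumFieldTheory.Balaban1983to89.Beta
open B6BondElimination (unitVec)
open ExpKernelCalculus (MKer Decays BiLoc VertexFamily VertexFamily₂ comp)
open KernelWard (divV divW bdd_of_biLoc)
open AffineAveraging (Site box toSite)
open OneStepResolventKernel (Fib wsum LocStencil biLoc_mono)
open OneStepKernelFamily (colH vertexOfK)
open InterLevelTransport (cwsum)
open BalabanStepJetsSucc (mmRead wE wVH)
open SecondOrderResponse (colM vertexOfM dM LocStencilFM)
open BalabanCompositeJets (LocStencil₂)
open BalabanStepW2 (M2Of wV4 wB2)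
open StepJetData (wilsonA locStencil_add)
open WilsonBiStencil (wilsonW₂)
open Summit.QuantumFields.BalabanUV.Beta.TameKernelCalculus
open Summit.QuantumFields.BalabanUV.Beta.ChartConjugation (conjV)
open Summit.QuantumFields.BalabanUV.Beta.ChartConjugationRelative (RelInv)
open Summit.QuantumFields.BalabanUV.Beta.BorderedHessian (diagK sgnK)
open Summit.QuantumFields.BalabanUV.Beta.AveragingWardRootedStencils (legInd)
open Summit.QuantumFields.BalabanUV.Beta.SpineRooted (SpureRecOf T2RecOf WrecOf locStencil_SpureRecOf)
open Summit.QuantumFields.BalabanUV.Beta.WardLocusRecursive (SrecOf)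
open Summit.QuantumFields.BalabanUV.Beta.KernelWardRelative (gaugeWt)
open Summit.QuantumFields.BalabanUV.Beta.BubbleParity (spr_of_decays)
open Summit.QuantumFields.BalabanUV.Beta.KernelWardRemainderParity (parityOdd_add)
open Summit.QuantumFields.BalabanUV.Beta.WardLocusRecursiveAllSlot (divW_WrecOf_zero_of_letters divW_WrecOf_succ_of_kernelLaw)
open Summit.QuantumFields.BalabanUV.Beta.WardLocusResidualSlot (exists_vertexFamily_residual_slot parityOdd_residual_slot exists_locStencil_transport_slot
  exists_bound_transport_slot parityOdd_transport_slot)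

namespace Summit.QuantumFields.BalabanUV.Beta.WardLocusRecursiveLettersSlot

section Slot

variable {d Lc : ℕ} [NeZero Lc]
variable {V H : Fin (d + 1) → (Fin (d + 1) → ℤ) → MKer (d + 1) (Fib d)} {G : ℕ → MKer (d + 1) (Fib d)}
  {M : ℕ → Fin (d + 1) → (Fin (d + 1) → ℤ) → MKer (d + 1) (Fib d)}

/-! ## §1 The all-levels kernel law with a classified, parity-odd residual, from the letters -/

/-- [folklore] **THE WARD KERNEL LAW OF THE SLOTTED W-TABLES AT EVERY LEVEL, FROM THE LETTERS** (root `toSite r`, generator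
`X y = diagK (ξ • Σ_v legInd (toSite r) (Lc•y+v))`, constants `cH j`, generic pins `cE cVH cΛ cE₂ cB`).  From the slots' letters, the resolvent sockets of every
level (incl. sgn-symmetry), the row parities of `SpureRecOf … j` and `M j`, the locks, and the LETTERS — border (both slots, every level), mixed (every level),
level-`0` Wilson — with remainders classified (one rate per level) and row-parity-odd — there is a residual family `Nr` with, for EVERY `j`: a uniform
vertex-family class, parity-odd rows, and the kernel law `divW (WrecOf … j) y ν y′ = conjV (dM (G j) …) (X y) + Nr j y ν y′`.  Proof: `Nr` by recursion on `j`; ONE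
induction carrying (class ∧ parity ∧ law) with parts C and Q. -/
theorem exists_kernelLaws_of_letters_slot (hLc : 1 ≤ Lc) (hV : ∀ δ : ℝ, 0 ≤ δ → ∃ C : ℝ, LocStencil V C δ)
    (hH : ∀ δ : ℝ, 0 ≤ δ → ∃ C : ℝ, VertexFamily H Lc C δ)
    (hG : ∀ j : ℕ, ∃ δ C : ℝ, 0 < δ ∧ 0 ≤ C ∧ Decays (G j) C δ) (hM : ∀ j : ℕ, ∃ CM δ : ℝ, 0 < δ ∧ VertexFamily (M j) Lc CM δ)
    (cE cVH cΛ cE₂ cB : ℝ) (T : Fin 4 → Fin 4 → Fin 4 → Fin 4 → ℝ)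
    {vh₂S : Fin (d + 1) → (Fin (d + 1) → ℤ) → Fin (d + 1) → (Fin (d + 1) → ℤ) → MKer (d + 1) (Fib d)}
    (hB : ∃ C δ : ℝ, 0 < δ ∧ LocStencil₂ vh₂S C δ)
    {mixFF : Fin (d + 1) → (Fin (d + 1) → ℤ) → Fin (d + 1) → (Fin (d + 1) → ℤ) → MKer (d + 1) (Fib d)}
    (hmix : ∃ C δ : ℝ, 0 < δ ∧ LocStencilFM Lc mixFF C δ)
    -- the resolvent sockets, every level
    (𝕄 : ℕ → MKer (d + 1) (Fib d)) (h𝕄 : ∀ j, Spr (𝕄 j)) (E : MKer (d + 1) (Fib d)) (hE : Spr E) (hR : ∀ j, RelInv (G j) (𝕄 j) E)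
    (cH : ℕ → ℝ)
    (hHc : ∀ (j : ℕ) (y : Fin (d + 1) → ℤ) (κ' : Fin (d + 1)) (u : Fin (d + 1) → ℤ),
      ∑ μ, (colH (G j) Lc μ (y - unitVec μ) κ' u - colH (G j) Lc μ y κ' u) = cH j * gaugeWt Lc y κ' u)
    (hMw : ∀ (j : ℕ) (y : Fin (d + 1) → ℤ) (ρ : Fin (d + 1)) (w : Fin (d + 1) → ℤ),
      ∑ μ, (colM (G j) Lc μ (y - unitVec μ) ρ w - colM (G j) Lc μ y ρ w) = 0)
    (hoff : ∀ (j : ℕ) (x : Fin (d + 1) → ℤ), Literature.Probability.LatticeModels.Torus.proj Lc x ≠ 0 →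
      ∀ (z : Fin (d + 1) → ℤ) (ρ μ : Fin (d + 1)), G j x z (Sum.inr ρ) (Sum.inr μ) = 0)
    {r : Fin (d + 1) → ℕ} (hr : r ∈ box (d + 1) Lc) (ξ : ℝ)
    (hEX : ∀ y : Fin (d + 1) → ℤ, comp E (diagK (ξ • ∑ v ∈ box (d + 1) Lc, legInd (toSite r) ((Lc : ℤ) • y + toSite v))) =
      comp (diagK (ξ • ∑ v ∈ box (d + 1) Lc, legInd (toSite r) ((Lc : ℤ) • y + toSite v))) E)
    (hD : ∀ (j : ℕ) (y : Fin (d + 1) → ℤ), divV (dM (G j) Lc (SpureRecOf d Lc V H G cE cVH cΛ j) (M j)) y = conjV (𝕄 j) (diagK (ξ • ∑ v ∈ box (d + 1) Lc, legInd (toSite r) ((Lc : ℤ) • y + toSite v))))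
    (hc1 : ∀ (j : ℕ) (κ : Fin (d + 1)) (u : Fin (d + 1) → ℤ),
      dM (G j) Lc (SpureRecOf d Lc V H G cE cVH cΛ j) (M j) κ u = vertexOfK (G j) Lc (SrecOf d Lc V H G cE cVH cΛ j) κ u)
    (hGt : ∀ j, trK (G j) = sgnK (G j))
    -- the row parities of the first-order tables
    (hSp : ∀ (j : ℕ) (κ : Fin (d + 1)) (u : Fin (d + 1) → ℤ), trK (SpureRecOf d Lc V H G cE cVH cΛ j κ u) = -sgnK (SpureRecOf d Lc V H G cE cVH cΛ j κ u))
    (hMp : ∀ (j : ℕ) (ρ : Fin (d + 1)) (w : Fin (d + 1) → ℤ), trK (M j ρ w) = -sgnK (M j ρ w))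
    -- the units locks
    (hlock : ∀ j : ℕ, cH (j + 1) * (cE₂ * wV4 d Lc (j + 1)) * ξ = (cE * wE d Lc (j + 1)) * ξ)
    -- the LETTERS' remainders, their classes (one rate per level) and row parities
    {RW RW'' : (Fin (d + 1) → ℤ) → Fin (d + 1) → (Fin (d + 1) → ℤ) → MKer (d + 1) (Fib d)}
    {RB RB'' : ℕ → (Fin (d + 1) → ℤ) → Fin (d + 1) → (Fin (d + 1) → ℤ) → MKer (d + 1) (Fib d)}
    {RM : ℕ → (Fin (d + 1) → ℤ) → Fin (d + 1) → (Fin (d + 1) → ℤ) → MKer (d + 1) (Fib d)}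
    (hcls0 : ∃ C δ : ℝ, 0 < δ ∧ (∀ Y, LocStencil (RW Y) C δ) ∧ (∀ Y, LocStencil (RW'' Y) C δ) ∧ (∀ Y, LocStencil (RB 0 Y) C δ) ∧
      (∀ Y, LocStencil (RB'' 0 Y) C δ) ∧ (∀ y, VertexFamily (RM 0 y) Lc C δ))
    (hclsS : ∀ j : ℕ, ∃ C δ : ℝ, 0 < δ ∧ (∀ Y, LocStencil (RB (j + 1) Y) C δ) ∧ (∀ Y, LocStencil (RB'' (j + 1) Y) C δ) ∧
      (∀ y, VertexFamily (RM (j + 1) y) Lc C δ))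
    (hRWp : ∀ Y κ u, trK (RW Y κ u) = -sgnK (RW Y κ u)) (hRW''p : ∀ Y κ u, trK (RW'' Y κ u) = -sgnK (RW'' Y κ u))
    (hRBp : ∀ j Y κ u, trK (RB j Y κ u) = -sgnK (RB j Y κ u)) (hRB''p : ∀ j Y κ u, trK (RB'' j Y κ u) = -sgnK (RB'' j Y κ u))
    (hRMp : ∀ j y ρ' w, trK (RM j y ρ' w) = -sgnK (RM j y ρ' w))
    -- the LETTERS
    (hWil : ∀ (Y : Fin (d + 1) → ℤ) (κ' : Fin (d + 1)) (u' : Fin (d + 1) → ℤ),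
      cH 0 • ∑ v ∈ box (d + 1) Lc, divV (fun κ u => cE₂ • wilsonW₂ d T κ u κ' u') ((Lc : ℤ) • Y + toSite v) =
        comp (cE • wilsonA d κ' u') (diagK (ξ • ∑ v ∈ box (d + 1) Lc, legInd (toSite r) ((Lc : ℤ) • Y + toSite v))) - comp (diagK (ξ • ∑ v ∈ box (d + 1) Lc, legInd (toSite r) ((Lc : ℤ) • Y + toSite v))) (cE • wilsonA d κ' u') + RW Y κ' u')
    (hWil'' : ∀ (Y : Fin (d + 1) → ℤ) (κ : Fin (d + 1)) (u : Fin (d + 1) → ℤ),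
      cH 0 • ∑ v ∈ box (d + 1) Lc, divV (fun κ' u' => cE₂ • wilsonW₂ d T κ u κ' u') ((Lc : ℤ) • Y + toSite v) =
        comp (cE • wilsonA d κ u) (diagK (ξ • ∑ v ∈ box (d + 1) Lc, legInd (toSite r) ((Lc : ℤ) • Y + toSite v))) - comp (diagK (ξ • ∑ v ∈ box (d + 1) Lc, legInd (toSite r) ((Lc : ℤ) • Y + toSite v))) (cE • wilsonA d κ u) + RW'' Y κ u)
    (hBord0 : ∀ (Y : Fin (d + 1) → ℤ) (κ' : Fin (d + 1)) (u' : Fin (d + 1) → ℤ),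
      cH 0 • ∑ v ∈ box (d + 1) Lc, divV (fun κ u => cB • vh₂S κ u κ' u') ((Lc : ℤ) • Y + toSite v) =
        comp (cVH • V κ' u') (diagK (ξ • ∑ v ∈ box (d + 1) Lc, legInd (toSite r) ((Lc : ℤ) • Y + toSite v))) - comp (diagK (ξ • ∑ v ∈ box (d + 1) Lc, legInd (toSite r) ((Lc : ℤ) • Y + toSite v))) (cVH • V κ' u') + RB 0 Y κ' u')
    (hBord0'' : ∀ (Y : Fin (d + 1) → ℤ) (κ : Fin (d + 1)) (u : Fin (d + 1) → ℤ),
      cH 0 • ∑ v ∈ box (d + 1) Lc, divV (fun κ' u' => cB • vh₂S κ u κ' u') ((Lc : ℤ) • Y + toSite v) =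
        comp (cVH • V κ u) (diagK (ξ • ∑ v ∈ box (d + 1) Lc, legInd (toSite r) ((Lc : ℤ) • Y + toSite v))) - comp (diagK (ξ • ∑ v ∈ box (d + 1) Lc, legInd (toSite r) ((Lc : ℤ) • Y + toSite v))) (cVH • V κ u) + RB'' 0 Y κ u)
    (hBordS : ∀ (j : ℕ) (Y : Fin (d + 1) → ℤ) (κ' : Fin (d + 1)) (u' : Fin (d + 1) → ℤ),
      cH (j + 1) • ∑ v ∈ box (d + 1) Lc, divV (fun κ u => (cB * wB2 d Lc (j + 1)) • vh₂S κ u κ' u') ((Lc : ℤ) • Y + toSite v) =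
        comp ((cVH * wVH d Lc (j + 1)) • V κ' u') (diagK (ξ • ∑ v ∈ box (d + 1) Lc, legInd (toSite r) ((Lc : ℤ) • Y + toSite v)))
          - comp (diagK (ξ • ∑ v ∈ box (d + 1) Lc, legInd (toSite r) ((Lc : ℤ) • Y + toSite v))) ((cVH * wVH d Lc (j + 1)) • V κ' u') + RB (j + 1) Y κ' u')
    (hBordS'' : ∀ (j : ℕ) (Y : Fin (d + 1) → ℤ) (κ : Fin (d + 1)) (u : Fin (d + 1) → ℤ),
      cH (j + 1) • ∑ v ∈ box (d + 1) Lc, divV (fun κ' u' => (cB * wB2 d Lc (j + 1)) • vh₂S κ u κ' u') ((Lc : ℤ) • Y + toSite v) =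
        comp ((cVH * wVH d Lc (j + 1)) • V κ u) (diagK (ξ • ∑ v ∈ box (d + 1) Lc, legInd (toSite r) ((Lc : ℤ) • Y + toSite v)))
          - comp (diagK (ξ • ∑ v ∈ box (d + 1) Lc, legInd (toSite r) ((Lc : ℤ) • Y + toSite v))) ((cVH * wVH d Lc (j + 1)) • V κ u) + RB'' (j + 1) Y κ u)
    (hM₂ : ∀ (j : ℕ) (y : Fin (d + 1) → ℤ) (ρ' : Fin (d + 1)) (w : Fin (d + 1) → ℤ),
      cH j • ∑ v ∈ box (d + 1) Lc, divV (fun κ u => M2Of d Lc mixFF j κ u ρ' w) ((Lc : ℤ) • y + toSite v) =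
        comp (M j ρ' w) (diagK (ξ • ∑ v ∈ box (d + 1) Lc, legInd (toSite r) ((Lc : ℤ) • y + toSite v))) - comp (diagK (ξ • ∑ v ∈ box (d + 1) Lc, legInd (toSite r) ((Lc : ℤ) • y + toSite v))) (M j ρ' w) + RM j y ρ' w) :
    ∃ Nr : ℕ → (Fin (d + 1) → ℤ) → Fin (d + 1) → (Fin (d + 1) → ℤ) → MKer (d + 1) (Fib d),
      (∀ j, ∃ C δ : ℝ, 0 < δ ∧ ∀ y, VertexFamily (Nr j y) Lc C δ) ∧
      (∀ j y ν y', trK (Nr j y ν y') = -sgnK (Nr j y ν y')) ∧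
      (∀ (j : ℕ) (y : Fin (d + 1) → ℤ) (ν : Fin (d + 1)) (y' : Fin (d + 1) → ℤ),
        divW (WrecOf d Lc G (SpureRecOf d Lc V H G cE cVH cΛ) M cE₂ cB T vh₂S mixFF j) y ν y' =
          conjV (dM (G j) Lc (SpureRecOf d Lc V H G cE cVH cΛ j) (M j) ν y') (diagK (ξ • ∑ v ∈ box (d + 1) Lc, legInd (toSite r) ((Lc : ℤ) • y + toSite v))) + Nr j y ν y') := by
  have hS : ∀ j : ℕ, ∃ Cs δ : ℝ, 0 < δ ∧ LocStencil (SpureRecOf d Lc V H G cE cVH cΛ j) Cs δ := locStencil_SpureRecOf (d := d) hLc hV hH hG cE cVH cΛ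
  -- the residual family, by recursion on the level
  let N0 : (Fin (d + 1) → ℤ) → Fin (d + 1) → (Fin (d + 1) → ℤ) → MKer (d + 1) (Fib d) := fun y ν y' =>
    (1 / 2 : ℝ) • (
              (dM (G 0) Lc (fun κ u => RW y κ u + RB 0 y κ u) (RM 0 y) ν y'
                - cH 0 • (∑ κ, wsum (fun u => ∑' x₂, ∑ κ₂,
                    comp (G 0) (dM (G 0) Lc (SpureRecOf d Lc V H G cE cVH cΛ 0) (M 0) ν y') u x₂ (Sum.inl κ) (Sum.inl κ₂) * gaugeWt Lc y κ₂ x₂) (SpureRecOf d Lc V H G cE cVH cΛ 0 κ)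
                  + ∑ ρ', cwsum Lc (fun w => ∑' x₂, ∑ κ₂,
                    comp (G 0) (dM (G 0) Lc (SpureRecOf d Lc V H G cE cVH cΛ 0) (M 0) ν y') ((Lc : ℤ) • w) x₂ (Sum.inr ρ') (Sum.inl κ₂) * gaugeWt Lc y κ₂ x₂) (M 0 ρ')))
              + (dM (G 0) Lc (fun κ u => RW'' y κ u + RB'' 0 y κ u) (RM 0 y) ν y'
                + dM (conjV (G 0) (diagK (ξ • ∑ v ∈ box (d + 1) Lc, legInd (toSite r) ((Lc : ℤ) • y + toSite v)))) Lc (SpureRecOf d Lc V H G cE cVH cΛ 0) (M 0) ν y'))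
  let NS : ℕ → ((Fin (d + 1) → ℤ) → Fin (d + 1) → (Fin (d + 1) → ℤ) → MKer (d + 1) (Fib d)) →
      (Fin (d + 1) → ℤ) → Fin (d + 1) → (Fin (d + 1) → ℤ) → MKer (d + 1) (Fib d) := fun j 𝒩 => fun y ν y' =>
    (1 / 2 : ℝ) • (
              (dM (G (j + 1)) Lc (fun κ' u' => -(cH (j + 1) * (cE₂ * wV4 d Lc (j + 1))) •
                      ∑ v ∈ box (d + 1) Lc, mmRead Lc (comp (comp (G j) (𝒩 ((Lc : ℤ) • y + toSite v) κ' u')) (G j))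
                    + RB (j + 1) y κ' u') (RM (j + 1) y) ν y'
                - cH (j + 1) • (∑ κ, wsum (fun u => ∑' x₂, ∑ κ₂,
                    comp (G (j + 1)) (dM (G (j + 1)) Lc (SpureRecOf d Lc V H G cE cVH cΛ (j + 1)) (M (j + 1)) ν y') u x₂ (Sum.inl κ) (Sum.inl κ₂) * gaugeWt Lc y κ₂ x₂) (SpureRecOf d Lc V H G cE cVH cΛ (j + 1) κ)
                  + ∑ ρ', cwsum Lc (fun w => ∑' x₂, ∑ κ₂,
                    comp (G (j + 1)) (dM (G (j + 1)) Lc (SpureRecOf d Lc V H G cE cVH cΛ (j + 1)) (M (j + 1)) ν y') ((Lc : ℤ) • w) x₂ (Sum.inr ρ') (Sum.inl κ₂) * gaugeWt Lc y κ₂ x₂) (M (j + 1) ρ')))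
              + (dM (G (j + 1)) Lc (fun κ u => -(cH (j + 1) * (cE₂ * wV4 d Lc (j + 1))) •
                      ∑ v ∈ box (d + 1) Lc, mmRead Lc (comp (comp (G j) (𝒩 ((Lc : ℤ) • y + toSite v) κ u)) (G j))
                    + RB'' (j + 1) y κ u) (RM (j + 1) y) ν y'
                + dM (conjV (G (j + 1)) (diagK (ξ • ∑ v ∈ box (d + 1) Lc, legInd (toSite r) ((Lc : ℤ) • y + toSite v)))) Lc (SpureRecOf d Lc V H G cE cVH cΛ (j + 1)) (M (j + 1)) ν y'))
  let Nr : ℕ → (Fin (d + 1) → ℤ) → Fin (d + 1) → (Fin (d + 1) → ℤ) → MKer (d + 1) (Fib d) := fun j => Nat.rec N0 NS j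
  have hNr0 : Nr 0 = N0 := rfl
  have hNrS : ∀ j, Nr (j + 1) = NS j (Nr j) := fun j => rfl
  refine ⟨Nr, ?_⟩
  -- ONE induction carrying class ∧ parity ∧ law
  have key : ∀ j : ℕ,
      (∃ C δ : ℝ, 0 < δ ∧ ∀ y, VertexFamily (Nr j y) Lc C δ) ∧
      (∀ y ν y', trK (Nr j y ν y') = -sgnK (Nr j y ν y')) ∧
      (∀ (y : Fin (d + 1) → ℤ) (ν : Fin (d + 1)) (y' : Fin (d + 1) → ℤ),
        divW (WrecOf d Lc G (SpureRecOf d Lc V H G cE cVH cΛ) M cE₂ cB T vh₂S mixFF j) y ν y' =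
          conjV (dM (G j) Lc (SpureRecOf d Lc V H G cE cVH cΛ j) (M j) ν y') (diagK (ξ • ∑ v ∈ box (d + 1) Lc, legInd (toSite r) ((Lc : ℤ) • y + toSite v))) + Nr j y ν y') := by
    intro j
    induction j with
    | zero =>
      obtain ⟨C0, δ0, hδ0, hRWl, hRW''l, hRBl, hRB''l, hRMl⟩ := hcls0
      have hRl : ∀ Y, LocStencil (fun κ u => RW Y κ u + RB 0 Y κ u) (C0 + C0) δ0 := fun Y => locStencil_add (hRWl Y) (hRBl Y)
      have hR''l : ∀ Y, LocStencil (fun κ u => RW'' Y κ u + RB'' 0 Y κ u) (C0 + C0) δ0 := fun Y => locStencil_add (hRW''l Y) (hRB''l Y)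
      refine ⟨?_, ?_, ?_⟩
      · obtain ⟨C, δ, hδ, h⟩ := exists_vertexFamily_residual_slot (hG 0) (hS 0) (hM 0) (cH 0) r ξ
          (R := fun Y κ u => RW Y κ u + RB 0 Y κ u) (R'' := fun Y κ u => RW'' Y κ u + RB'' 0 Y κ u) (RM := RM 0) hδ0 hRl hδ0 hR''l hδ0 hRMl
        exact ⟨C, δ, hδ, fun y => by rw [hNr0]; exact h y⟩
      · intro y ν y'
        rw [hNr0]
        exact parityOdd_residual_slot (hSp 0) (hMp 0) (cH 0) r ξ (R := fun Y κ u => RW Y κ u + RB 0 Y κ u)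
          (R'' := fun Y κ u => RW'' Y κ u + RB'' 0 Y κ u) (RM := RM 0) (fun Y κ u => parityOdd_add (hRWp Y κ u) (hRBp 0 Y κ u))
          (fun Y κ u => parityOdd_add (hRW''p Y κ u) (hRB''p 0 Y κ u)) (hRMp 0) y ν y'
      · intro y ν y'
        rw [hNr0]
        exact divW_WrecOf_zero_of_letters hLc hV hH hG hM cE cVH cΛ cE₂ cB T hB hmix 𝕄 h𝕄 E hE hR cH hHc hMw hoff ξ hEX hD
          (fun Y κ u x z a b => bdd_of_biLoc (hRWl Y κ u) hδ0.le x z a b) (fun Y κ u x z a b => bdd_of_biLoc (hRW''l Y κ u) hδ0.le x z a b)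
          (fun Y κ u x z a b => bdd_of_biLoc (hRBl Y κ u) hδ0.le x z a b) (fun Y κ u x z a b => bdd_of_biLoc (hRB''l Y κ u) hδ0.le x z a b)
          (fun y ρ' w x z a b => bdd_of_biLoc (hRMl y ρ' w) hδ0.le x z a b) hWil hWil'' hBord0 hBord0'' (hM₂ 0) y ν y'
    | succ j ih =>
      obtain ⟨⟨CN, δN, hδN, hcls⟩, hpar, hlaw⟩ := ih
      obtain ⟨CL, δL, hδL, hRBl, hRB''l, hRMl⟩ := hclsS j
      have h𝒩 : ∀ y ν y', Loc (Nr j y ν y') := fun y ν y' => ⟨_, _, _, δN, hδN, hcls y ν y'⟩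
      obtain ⟨B𝒩, h𝒩b⟩ := exists_bound_transport_slot (K := G j) hLc (hG j) hδN hcls
      -- the two transported remainders of level j+1 (first and second slot) with their classes and parities
      obtain ⟨CR, δR, hδR, hRl⟩ := exists_locStencil_transport_slot (K := G j) hLc (hG j)
        (-(cH (j + 1) * (cE₂ * wV4 d Lc (j + 1)))) hδN hcls hδL hRBl
      obtain ⟨CR'', δR'', hδR'', hR''l⟩ := exists_locStencil_transport_slot (K := G j) hLc (hG j)
        (-(cH (j + 1) * (cE₂ * wV4 d Lc (j + 1)))) hδN hcls hδL hRB''l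
      have hRp := fun Y κ u => parityOdd_transport_slot (Lc := Lc) (spr_of_decays (hG j)) (hGt j) (-(cH (j + 1) * (cE₂ * wV4 d Lc (j + 1))))
        h𝒩 hpar (hRBp (j + 1)) Y κ u
      have hR''p := fun Y κ u => parityOdd_transport_slot (Lc := Lc) (spr_of_decays (hG j)) (hGt j) (-(cH (j + 1) * (cE₂ * wV4 d Lc (j + 1))))
        h𝒩 hpar (hRB''p (j + 1)) Y κ u
      refine ⟨?_, ?_, ?_⟩
      · obtain ⟨C, δ, hδ, h⟩ := exists_vertexFamily_residual_slot (hG (j + 1)) (hS (j + 1)) (hM (j + 1)) (cH (j + 1)) r ξ hδR hRl hδR'' hR''l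
          hδL hRMl
        exact ⟨C, δ, hδ, fun y => by rw [hNrS]; exact h y⟩
      · intro y ν y'
        rw [hNrS]
        exact parityOdd_residual_slot (hSp (j + 1)) (hMp (j + 1)) (cH (j + 1)) r ξ hRp hR''p (hRMp (j + 1)) y ν y'
      · intro y ν y'
        rw [hNrS]
        exact divW_WrecOf_succ_of_kernelLaw hLc hV hH hG hM cE cVH cΛ cE₂ cB T hB hmix 𝕄 h𝕄 E hE hR cH hHc hMw hoff hr ξ hEX hD hc1 j h𝒩 hlaw
          h𝒩b h𝒩b (hlock j)
          (fun Y κ u x z a b => bdd_of_biLoc (hRBl Y κ u) hδL.le x z a b) (fun Y κ u x z a b => bdd_of_biLoc (hRB''l Y κ u) hδL.le x z a b)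
          (hBordS j) (hBordS'' j) (fun y ρ' w x z a b => bdd_of_biLoc (hRMl y ρ' w) hδL.le x z a b) (hM₂ (j + 1)) y ν y'
  exact ⟨fun j => (key j).1, fun j => (key j).2.1, fun j => (key j).2.2⟩

end Slot

end Summit.QuantumFields.BalabanUV.Beta.WardLocusRecursiveLettersSlot

end
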